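import Literature.MathematicalPhysics.QuantumLattice.LiebWuChemicalPotentialPairing
import HarnessLib

/-!
# Lieb–Wu 2003, §7.1: the first-order response of the momentum density at half filling,
# eq. (dint) `∫₀^{π/2} δρ cos k ≈ a[ρ₀(0) - 1/π] ∫_{-1}^{1} √(1-x²) u(x) dx`

E. H. Lieb, F. Y. Wu, Physica A 321 (2003) 1, §7.1 (arXiv:cond-mat/0207529 p. 16): with `B = ∞`, `Q = π - a`,
`δρ = ρ - ρ₀`, `δf = f - f₀`,

> We turn to (fiterate2) and find, to leading order, that `f ≈ … = f₀ + ûâf₀ - 2ûât` … Therefore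
> `∫₀^{π/2} δρ cos k ≈ a[ρ₀(0) - 1/π] ∫_{-1}^{1} √(1 - x²) u(x) dx`.   (dint)

In the tree's `B = ∞` machinery (`σ_Q = ξ_Q + Ŵ_Q σ_Q`, `G_Q = σ_Q ∗ K`, `ρ_Q(k) = 1/2π + cos k · G_Q(sin k)`)
the same first-order computation reads `σ_Q - σ_π = (ξ_Q - ξ_π) + Ŵ_Q σ_Q` (`LiebWuChemicalPotentialPairing`),
`ξ_Q - ξ_π ≈ -((π - Q)/2π) r`, `Ŵ_Q σ_Q ≈ a G_π(0) r`, `G_π(0) = ρ₀(0) - 1/2π`, and, tested against the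
`cos²`-moment `V` of the Cauchy kernel (`LiebWuChemicalPotentialKernel`: `∫ r V = 4∫₀^∞ J₁/(ω(1 + e^{ωU/2}))`),
gives the momentum form of (dint) with an explicit second-order remainder:

* `abs_integral_cos_sq_mul_liebWuG_sub_sub_le`: for `U > 0` there is `C` with
  `|∫_{-π}^{π} cos²k (G_Q - G_π)(sin k) dk - (π - Q)(G_π(0) - 1/2π) · 4∫₀^∞ J₁/(ω(1 + e^{ωU/2}))| ≤ C (π - Q)²`
  for all `Q ∈ [π - 1, π]` (note `∫_{-π}^{π} cos²k δG(sin k) dk = 4∫₀^{π/2} δρ cos k dk`).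

The energy expansion (finaldeltae) and the quotient (mmu) follow in `LiebWuChemicalPotentialEnergy.lean`.

No named facts; all statements proved.

## References

* E. H. Lieb, F. Y. Wu, Physica A 321 (2003) 1–27 = arXiv:cond-mat/0207529, §7.1, eqs. (deltaf), (dint)
  [LiebWuPhysicaA2003].
-/

noncomputable section

open MeasureTheory Set Real Filter intervalIntegral
open Literature.Analysis.SpecialFunctions Literature.Analysis.FunctionSpaces
open scoped Topology Interval

namespace Literature.MathematicalPhysics.QuantumLattice

variable {U Q : ℝ}

/-! ### The momentum form of eq. (dint) with a second-order remainder -/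

set_option maxHeartbeats 1600000 in
/-- **Lieb–Wu 2003, eq. (dint), quantitative momentum form.** For `U > 0` there is `C` such that for all
`Q ∈ [π - 1, π]`
`|∫_{-π}^{π} cos²k (G_Q - G_π)(sin k) dk - (π - Q)(G_π(0) - 1/2π) · 4∫₀^∞ J₁/(ω(1 + e^{ωU/2})) dω| ≤ C (π - Q)²`;
here `∫_{-π}^{π} cos²k (G_Q - G_π)(sin k) dk = 4∫₀^{π/2} δρ cos k dk`, `G_π(0) - 1/2π = ρ₀(0) - 1/π` and
`4∫₀^∞ J₁/(ω(1 + e^{ωU/2})) = 4∫_{-1}^{1} √(1 - x²) u(x) dx`, so this is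
`∫₀^{π/2} δρ cos k ≈ a[ρ₀(0) - 1/π] ∫_{-1}^{1} √(1 - x²) u` with an `O(a²)` error. [cite: LiebWuPhysicaA2003, §7.1, eq. (dint)] -/
theorem abs_integral_cos_sq_mul_liebWuG_sub_sub_le (hU : 0 < U) :
    ∃ C : ℝ, ∀ Q ∈ Icc (π - 1) π,
      |(∫ k in (-π)..π, Real.cos k ^ 2 * (liebWuG U Q univ (Real.sin k) - liebWuG U π univ (Real.sin k))) -
          (π - Q) * (liebWuG U π univ 0 - 1 / (2 * π)) * (4 * ∫ ω in Ioi (0 : ℝ), liebWuChargeGapIntegrand U ω)|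
        ≤ C * (π - Q) ^ 2 := by
  have hπ := Real.pi_pos
  have hc : 0 < U / 4 := by positivity
  set c : ℝ := U / 4 with hc_def
  -- notation
  set V : ℝ → ℝ := fun t => ∫ k in (-π)..π, Real.cos k ^ 2 * cauchyDensity (U / 4) (Real.sin k - t) with hV
  set R : ℝ → ℝ := fun y => ∫ t, sechKernel (U / 4) (t - y) * V t with hR
  set Gπ : ℝ → ℝ := liebWuG U π univ with hGπ_def
  set I4 : ℝ := 4 * ∫ ω in Ioi (0 : ℝ), liebWuChargeGapIntegrand U ω with hI4
  have hVc : Continuous V := continuous_cosSqCauchy hU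
  have hVb : ∀ t, |V t| ≤ 2 / c := fun t => by
    rw [abs_of_nonneg (cosSqCauchy_nonneg_le hU t).1]; exact (cosSqCauchy_nonneg_le hU t).2
  have hRdef : ∀ y, R y = ∫ t, sechKernel (U / 4) (t - y) * V t := fun y => rfl
  have hR0 : R 0 = I4 := by
    simp only [hR, sub_zero]
    exact integral_sechKernel_mul_cosSqCauchy hU
  have hRb : ∀ y, |R y| ≤ 2 / c := fun y => by
    rw [abs_of_nonneg (integral_sechKernel_sub_mul_cosSqCauchy_nonneg_le hU y).1]
    exact (integral_sechKernel_sub_mul_cosSqCauchy_nonneg_le hU y).2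
  have hRlip : ∀ y y', |R y - R y'| ≤ 2 * |y - y'| / c ^ 2 := fun y y' =>
    abs_integral_sechKernel_sub_mul_cosSqCauchy_sub_le hU y y'
  have hRc' : Continuous R := by
    have hK : (((2 / c ^ 2).toNNReal : NNReal) : ℝ) = 2 / c ^ 2 := Real.coe_toNNReal _ (by positivity)
    refine LipschitzWith.continuous (K := (2 / c ^ 2).toNNReal) (LipschitzWith.of_dist_le_mul fun y₁ y₂ => ?_)
    rw [hK, Real.dist_eq, Real.dist_eq]
    calc |R y₁ - R y₂| ≤ 2 * |y₁ - y₂| / c ^ 2 := hRlip y₁ y₂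
      _ = 2 / c ^ 2 * |y₁ - y₂| := by ring
  obtain ⟨hGπc, hGπ0, hGπi, hGπle⟩ := liebWuG_props hU hπ MeasurableSet.univ
  have hσπ : ∫ t, liebWuSigmaAtS U π univ t = 1 / 2 := by
    rw [liebWuSigmaAtS_univ]; exact integral_liebWuSigmaAt_pi hU
  have hGπb : ∀ y, Gπ y ≤ 1 / (π * c) * (1 / 2) := fun y => by rw [← hσπ]; exact hGπle y
  have hGπ00 : 0 ≤ Gπ 0 := hGπ0 0
  -- constants
  set B₁ : ℝ := 1 / (π * c) * (1 / π + 8 / (π * U)) with hB₁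
  set L : ℝ := 1 / (π * c ^ 2) * (1 / 2) with hL
  set M : ℝ := (B₁ + L) * (2 / c) + 1 / (π * c) * (1 / 2) * (2 / c ^ 2) with hM
  refine ⟨M + 1 / (4 * π) * 2 * (2 / c ^ 2) + 1 / (π * c) * (1 / 2) * |I4| / 6, fun Q hQI => ?_⟩
  obtain ⟨hQ1, hQπ⟩ := hQI
  have hQ : 0 < Q := by linarith [Real.pi_gt_three]
  have hQ2 : π / 2 ≤ Q := by linarith [Real.pi_gt_three]
  set x : ℝ := π - Q with hx_def
  have hx0 : 0 ≤ x := by linarith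
  have hx1 : x ≤ 1 := by linarith
  set a : ℝ := Real.sin Q with ha_def
  have ha_eq : a = Real.sin x := by rw [ha_def, hx_def, Real.sin_pi_sub]
  have ha0 : 0 ≤ a := by rw [ha_eq]; exact Real.sin_nonneg_of_nonneg_of_le_pi hx0 (by linarith)
  have hax : a ≤ x := by rw [ha_eq]; exact Real.sin_le hx0
  have hxa : x - a ≤ x ^ 3 / 6 := by
    rcases eq_or_lt_of_le hx0 with h | h
    · have : a = 0 := by rw [ha_eq, ← h, Real.sin_zero]
      rw [this, ← h]; norm_num
    · have := Real.sin_gt_sub_cube h; rw [ha_eq]; linarith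
  -- `|sin k| ≤ a` for `k ∈ [Q, π] ∪ [-π, -Q]`
  have hsin_tail : ∀ k, Q ≤ |k| → |k| ≤ π → |Real.sin k| ≤ a := by
    intro k hk1 hk2
    have key : ∀ k', Q ≤ k' → k' ≤ π → |Real.sin k'| ≤ a := by
      intro k' h1 h2
      have hs0 : 0 ≤ Real.sin k' := Real.sin_nonneg_of_nonneg_of_le_pi (by linarith) h2
      rw [abs_of_nonneg hs0, ha_def]
      -- `sin` is antitone on `[π/2, π]`
      have := Real.sin_le_sin_of_le_of_le_pi_div_two (x := π - k') (y := π - Q) (by linarith) (by linarith) (by linarith)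
      rwa [Real.sin_pi_sub, Real.sin_pi_sub] at this
    by_cases hk : 0 ≤ k
    · rw [abs_of_nonneg hk] at hk1 hk2; exact key k hk1 hk2
    · rw [abs_of_neg (lt_of_not_ge hk)] at hk1 hk2
      have := key (-k) hk1 hk2
      rwa [Real.sin_neg, abs_neg] at this
  -- Step 1: the integral as `∫ δσ V = ∫ δξ V + ∫ (Ŵσ) V`
  have hσi := integrable_liebWuSigmaAt hU hQ
  have hσπi := integrable_liebWuSigmaAt hU hπ
  have hσc := continuous_liebWuSigmaAt hU hQ
  have hσπc := continuous_liebWuSigmaAt hU hπ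
  have hIV : ∀ {h : ℝ → ℝ}, Integrable h → Integrable fun t => h t * V t := fun hh =>
    hh.mul_bdd hVc.aestronglyMeasurable (Eventually.of_forall fun t => by rw [Real.norm_eq_abs]; exact hVb t)
  obtain ⟨hξi, -⟩ := integrable_liebWuXi_and_integral hU hQ
  obtain ⟨hξπi, -⟩ := integrable_liebWuXi_and_integral hU hπ
  have hGQc := (liebWuG_props hU hQ MeasurableSet.univ).1
  have hstep1 : ∫ k in (-π)..π, Real.cos k ^ 2 * (liebWuG U Q univ (Real.sin k) - Gπ (Real.sin k)) =
      (∫ t, (liebWuXi U Q t - liebWuXi U π t) * V t) +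
        ∫ t, liebWuW U Q (liebWuSigmaAt U Q) t * V t := by
    have e1 : ∫ k in (-π)..π, Real.cos k ^ 2 * (liebWuG U Q univ (Real.sin k) - Gπ (Real.sin k)) =
        (∫ k in (-π)..π, Real.cos k ^ 2 * liebWuG U Q univ (Real.sin k)) -
          ∫ k in (-π)..π, Real.cos k ^ 2 * Gπ (Real.sin k) := by
      rw [← intervalIntegral.integral_sub ((by fun_prop : Continuous fun k => Real.cos k ^ 2 *
          liebWuG U Q univ (Real.sin k)).intervalIntegrable _ _)
        ((by fun_prop : Continuous fun k => Real.cos k ^ 2 * Gπ (Real.sin k)).intervalIntegrable _ _)]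
      exact intervalIntegral.integral_congr fun k _ => by ring
    have e2 : ∫ k in (-π)..π, Real.cos k ^ 2 * liebWuG U Q univ (Real.sin k) = ∫ t, liebWuSigmaAt U Q t * V t := by
      simp_rw [liebWuG_univ]; exact integral_cos_sq_mul_conv_cauchyDensity hU hσc hσi
    have e3 : ∫ k in (-π)..π, Real.cos k ^ 2 * Gπ (Real.sin k) = ∫ t, liebWuSigmaAt U π t * V t := by
      simp_rw [hGπ_def, liebWuG_univ]; exact integral_cos_sq_mul_conv_cauchyDensity hU hσπc hσπi
    have A : Integrable fun t => (liebWuXi U Q t - liebWuXi U π t) * V t := hIV (hξi.sub hξπi)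
    have B : Integrable fun t => liebWuW U Q (liebWuSigmaAt U Q) t * V t :=
      hIV (liebWuW_props hU hσi fun t => (liebWuSigmaAt_pos hU hQ t).le).2.2.1
    rw [e1, e2, e3, ← integral_sub (hIV hσi) (hIV hσπi), ← integral_add A B]
    refine integral_congr_ae (Eventually.of_forall fun t => ?_)
    show liebWuSigmaAt U Q t * V t - liebWuSigmaAt U π t * V t =
      (liebWuXi U Q t - liebWuXi U π t) * V t + liebWuW U Q (liebWuSigmaAt U Q) t * V t
    rw [← sub_mul, liebWuSigmaAt_sub_pi hU hQ t]
    ring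
  -- Step 2: the `ξ`-piece
  have hξV : ∫ t, (liebWuXi U Q t - liebWuXi U π t) * V t =
      -(1 / (4 * π)) * ((∫ k in (-π)..(-Q), R (Real.sin k)) + ∫ k in Q..π, R (Real.sin k)) := by
    have e : ∫ t, (liebWuXi U Q t - liebWuXi U π t) * V t =
        (∫ t, liebWuXi U Q t * V t) - ∫ t, liebWuXi U π t * V t := by
      rw [← integral_sub (hIV hξi) (hIV hξπi)]
      exact integral_congr_ae (Eventually.of_forall fun t => by ring)
    rw [e, integral_liebWuXi_mul_cosSqCauchy hU Q, integral_liebWuXi_mul_cosSqCauchy hU π]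
    have hRc : Continuous fun k => R (Real.sin k) := hRc'.comp Real.continuous_sin
    have hii : ∀ a' b', IntervalIntegrable (fun k => R (Real.sin k)) volume a' b' := fun a' b' =>
      hRc.intervalIntegrable _ _
    have hsplit : ∫ k in (-π)..π, R (Real.sin k) =
        (∫ k in (-π)..(-Q), R (Real.sin k)) + ((∫ k in (-Q)..Q, R (Real.sin k)) + ∫ k in Q..π, R (Real.sin k)) := by
      rw [integral_add_adjacent_intervals (hii _ _) (hii _ _), integral_add_adjacent_intervals (hii _ _) (hii _ _)]
    rw [hsplit]
    ring
  -- Step 3: the `Ŵ`-piece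
  have hWV : ∫ t, liebWuW U Q (liebWuSigmaAt U Q) t * V t =
      1 / 2 * ∫ y in Ioc (-a) a, liebWuG U Q univ y * R y := integral_liebWuW_mul_cosSqCauchy hU hQ
  -- Step 4: bounds on the pieces
  -- (4a) the tails of the `ξ`-piece: `|∫_Q^π (R(sin k) - R 0)| ≤ x · 2a/c²`
  have htailR : ∀ k ∈ Ι Q π, ‖R (Real.sin k) - R 0‖ ≤ 2 * a / c ^ 2 := by
    intro k hk
    rw [uIoc_of_le hQπ] at hk
    rw [Real.norm_eq_abs]
    have h := hRlip (Real.sin k) 0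
    rw [sub_zero] at h
    have hs := hsin_tail k (by rw [abs_of_nonneg (by linarith [hk.1])]; exact hk.1.le)
      (by rw [abs_of_nonneg (by linarith [hk.1])]; exact hk.2)
    calc |R (Real.sin k) - R 0| ≤ 2 * |Real.sin k| / c ^ 2 := h
      _ ≤ 2 * a / c ^ 2 := by gcongr
  have htailR' : ∀ k ∈ Ι (-π) (-Q), ‖R (Real.sin k) - R 0‖ ≤ 2 * a / c ^ 2 := by
    intro k hk
    rw [uIoc_of_le (by linarith : -π ≤ -Q)] at hk
    rw [Real.norm_eq_abs]
    have h := hRlip (Real.sin k) 0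
    rw [sub_zero] at h
    have hs := hsin_tail k (by rw [abs_of_nonpos (by linarith [hk.2])]; linarith [hk.2])
      (by rw [abs_of_nonpos (by linarith [hk.2])]; linarith [hk.1])
    calc |R (Real.sin k) - R 0| ≤ 2 * |Real.sin k| / c ^ 2 := h
      _ ≤ 2 * a / c ^ 2 := by gcongr
  have hRc2 : ∀ a' b', IntervalIntegrable (fun k => R (Real.sin k) - R 0) volume a' b' := fun a' b' =>
    ((hRc'.comp Real.continuous_sin).sub continuous_const).intervalIntegrable _ _
  have hRsi : ∀ a' b', IntervalIntegrable (fun k => R (Real.sin k)) volume a' b' := fun a' b' =>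
    (hRc'.comp Real.continuous_sin).intervalIntegrable _ _
  have hI1 : |(∫ k in Q..π, R (Real.sin k)) - x * R 0| ≤ 2 * a / c ^ 2 * x := by
    have e : (∫ k in Q..π, (R (Real.sin k) - R 0)) = (∫ k in Q..π, R (Real.sin k)) - x * R 0 := by
      rw [intervalIntegral.integral_sub (hRsi Q π) intervalIntegrable_const, intervalIntegral.integral_const,
        smul_eq_mul, hx_def]
    rw [← e]
    have h := intervalIntegral.norm_integral_le_of_norm_le_const htailR
    rw [Real.norm_eq_abs, show |π - Q| = x by rw [hx_def]; exact abs_of_nonneg (by linarith)] at h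
    exact h
  have hI1' : |(∫ k in (-π)..(-Q), R (Real.sin k)) - x * R 0| ≤ 2 * a / c ^ 2 * x := by
    have e : (∫ k in (-π)..(-Q), (R (Real.sin k) - R 0)) = (∫ k in (-π)..(-Q), R (Real.sin k)) - x * R 0 := by
      rw [intervalIntegral.integral_sub (hRsi (-π) (-Q)) intervalIntegrable_const, intervalIntegral.integral_const,
        smul_eq_mul, hx_def]
      ring
    rw [← e]
    have h := intervalIntegral.norm_integral_le_of_norm_le_const htailR'
    have habs : |(-Q) - -π| = x := by
      rw [hx_def, show (-Q) - -π = π - Q by ring]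
      exact abs_of_nonneg (by linarith)
    rw [Real.norm_eq_abs, habs] at h
    exact h
  -- (4b) the `Ŵ`-piece: `|½∫_S G R - a Gπ(0) R(0)| ≤ M x · a`
  have hD : ∫ t, |liebWuSigmaAt U Q t - liebWuSigmaAt U π t| ≤ x / π + 8 * Q / (π ^ 2 * U) * a := by
    have h := integral_abs_liebWuSigmaAt_sub_le hU hQ hQπ hπ le_rfl
    rw [Real.sin_pi, sub_zero, abs_of_nonneg ha0, show |Q - π| = x by
      rw [abs_sub_comm]; exact abs_of_nonneg hx0] at h
    exact h
  have hB1x : 1 / (π * c) * (x / π + 8 * Q / (π ^ 2 * U) * a) ≤ B₁ * x := by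
    have h8 : 8 * Q / (π ^ 2 * U) * a ≤ 8 / (π * U) * x := by
      have hQa : Q * a ≤ π * x := mul_le_mul hQπ hax ha0 hπ.le
      have : 8 * Q / (π ^ 2 * U) * a = 8 / (π ^ 2 * U) * (Q * a) := by ring
      rw [this]
      calc 8 / (π ^ 2 * U) * (Q * a) ≤ 8 / (π ^ 2 * U) * (π * x) := by gcongr
        _ = 8 / (π * U) * x := by field_simp
    calc 1 / (π * c) * (x / π + 8 * Q / (π ^ 2 * U) * a)
        ≤ 1 / (π * c) * (x / π + 8 / (π * U) * x) := by gcongr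
      _ = B₁ * x := by simp only [hB₁]; ring
  have hpt : ∀ y ∈ Ioc (-a) a, ‖liebWuG U Q univ y * R y - Gπ 0 * R 0‖ ≤ M * x := by
    intro y hy
    have hy' : |y| ≤ a := abs_le.2 ⟨hy.1.le, hy.2⟩
    rw [Real.norm_eq_abs]
    have h1 : |liebWuG U Q univ y - Gπ y| ≤ B₁ * x :=
      (abs_liebWuG_univ_sub_le hU hQ hπ y).trans (le_trans (by gcongr) hB1x)
    have h2 : |Gπ y - Gπ 0| ≤ L * a := by
      have h := abs_liebWuG_univ_sub_le_mul hU hπ y 0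
      rw [integral_liebWuSigmaAt_pi hU, sub_zero] at h
      refine h.trans ?_
      have : |y| / (π * (U / 4) ^ 2) * (1 / 2) = L * |y| := by simp only [hL, hc_def]; ring
      rw [this]
      exact mul_le_mul_of_nonneg_left hy' (by positivity)
    have h3 : |liebWuG U Q univ y - Gπ 0| ≤ B₁ * x + L * a := by
      calc |liebWuG U Q univ y - Gπ 0| = |(liebWuG U Q univ y - Gπ y) + (Gπ y - Gπ 0)| := by ring_nf
        _ ≤ |liebWuG U Q univ y - Gπ y| + |Gπ y - Gπ 0| := abs_add_le _ _
        _ ≤ B₁ * x + L * a := add_le_add h1 h2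
    have h4 : |R y - R 0| ≤ 2 * a / c ^ 2 := by
      calc |R y - R 0| ≤ 2 * |y - 0| / c ^ 2 := hRlip y 0
        _ ≤ 2 * a / c ^ 2 := by rw [sub_zero]; gcongr
    have hsplit : liebWuG U Q univ y * R y - Gπ 0 * R 0 =
        (liebWuG U Q univ y - Gπ 0) * R y + Gπ 0 * (R y - R 0) := by ring
    rw [hsplit]
    calc |(liebWuG U Q univ y - Gπ 0) * R y + Gπ 0 * (R y - R 0)|
        ≤ |(liebWuG U Q univ y - Gπ 0) * R y| + |Gπ 0 * (R y - R 0)| := abs_add_le _ _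
      _ = |liebWuG U Q univ y - Gπ 0| * |R y| + Gπ 0 * |R y - R 0| := by
          rw [abs_mul, abs_mul, abs_of_nonneg hGπ00]
      _ ≤ (B₁ * x + L * a) * (2 / c) + (1 / (π * c) * (1 / 2)) * (2 * a / c ^ 2) := by
          gcongr
          · exact hRb y
          · exact hGπb 0
      _ ≤ (B₁ * x + L * x) * (2 / c) + (1 / (π * c) * (1 / 2)) * (2 * x / c ^ 2) := by gcongr
      _ = M * x := by simp only [hM]; ring
  have hvolS : volume.real (Ioc (-a) a) = 2 * a := by
    rw [Real.volume_real_Ioc_of_le (by linarith)]; ring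
  have hWmain : |1 / 2 * (∫ y in Ioc (-a) a, liebWuG U Q univ y * R y) - a * (Gπ 0 * R 0)| ≤ M * x * a := by
    have hconst : ∫ y in Ioc (-a) a, Gπ 0 * R 0 = 2 * a * (Gπ 0 * R 0) := by
      rw [setIntegral_const, hvolS, smul_eq_mul]
    have hGRi : IntegrableOn (fun y => liebWuG U Q univ y * R y) (Ioc (-a) a) :=
      ((hGQc.mul hRc').continuousOn).integrableOn_compact isCompact_Icc |>.mono_set Ioc_subset_Icc_self
    have hci : IntegrableOn (fun _ : ℝ => Gπ 0 * R 0) (Ioc (-a) a) := integrable_const _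
    have e : 1 / 2 * (∫ y in Ioc (-a) a, liebWuG U Q univ y * R y) - a * (Gπ 0 * R 0) =
        1 / 2 * ∫ y in Ioc (-a) a, (liebWuG U Q univ y * R y - Gπ 0 * R 0) := by
      rw [integral_sub hGRi hci, hconst]
      ring
    rw [e, abs_mul, abs_of_pos (by norm_num : (0 : ℝ) < 1 / 2)]
    have h := norm_setIntegral_le_of_norm_le_const (μ := volume) measure_Ioc_lt_top hpt
    rw [Real.norm_eq_abs, hvolS] at h
    calc 1 / 2 * |∫ y in Ioc (-a) a, (liebWuG U Q univ y * R y - Gπ 0 * R 0)| ≤ 1 / 2 * (M * x * (2 * a)) := by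
          gcongr
      _ = M * x * a := by ring
  -- Step 5: assemble
  have hM0 : 0 ≤ M := by positivity
  have hT1 : |-(1 / (4 * π)) * (((∫ k in (-π)..(-Q), R (Real.sin k)) - x * R 0) +
      ((∫ k in Q..π, R (Real.sin k)) - x * R 0))| ≤ 1 / (4 * π) * (4 / c ^ 2) * x ^ 2 := by
    rw [abs_mul, abs_neg, abs_of_pos (by positivity : (0 : ℝ) < 1 / (4 * π)), mul_assoc]
    refine mul_le_mul_of_nonneg_left ?_ (by positivity)
    have hax' : 2 * a / c ^ 2 * x ≤ 2 * x / c ^ 2 * x := by gcongr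
    calc |((∫ k in (-π)..(-Q), R (Real.sin k)) - x * R 0) + ((∫ k in Q..π, R (Real.sin k)) - x * R 0)|
        ≤ |(∫ k in (-π)..(-Q), R (Real.sin k)) - x * R 0| + |(∫ k in Q..π, R (Real.sin k)) - x * R 0| :=
          abs_add_le _ _
      _ ≤ 2 * x / c ^ 2 * x + 2 * x / c ^ 2 * x := add_le_add (hI1'.trans hax') (hI1.trans hax')
      _ = 4 / c ^ 2 * x ^ 2 := by ring
  have hT2 : |1 / 2 * (∫ y in Ioc (-a) a, liebWuG U Q univ y * R y) - a * (Gπ 0 * R 0)| ≤ M * x ^ 2 := by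
    refine hWmain.trans ?_
    calc M * x * a ≤ M * x * x := mul_le_mul_of_nonneg_left hax (by positivity)
      _ = M * x ^ 2 := by ring
  have hT3 : |(a - x) * (Gπ 0 * R 0)| ≤ 1 / (π * c) * (1 / 2) * |I4| / 6 * x ^ 2 := by
    have hax3 : |a - x| ≤ x ^ 2 / 6 := by
      rw [abs_sub_comm, abs_of_nonneg (by linarith)]
      have hx2 : x ^ 3 ≤ x ^ 2 := pow_le_pow_of_le_one hx0 hx1 (by norm_num)
      linarith
    rw [abs_mul, abs_mul, hR0, abs_of_nonneg hGπ00]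
    calc |a - x| * (Gπ 0 * |I4|) ≤ x ^ 2 / 6 * (1 / (π * c) * (1 / 2) * |I4|) := by
          gcongr
          exact hGπb 0
      _ = 1 / (π * c) * (1 / 2) * |I4| / 6 * x ^ 2 := by ring
  have htotal : (∫ k in (-π)..π, Real.cos k ^ 2 * (liebWuG U Q univ (Real.sin k) - Gπ (Real.sin k))) -
      x * (Gπ 0 - 1 / (2 * π)) * I4 =
      -(1 / (4 * π)) * (((∫ k in (-π)..(-Q), R (Real.sin k)) - x * R 0) + ((∫ k in Q..π, R (Real.sin k)) - x * R 0)) +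
        (1 / 2 * (∫ y in Ioc (-a) a, liebWuG U Q univ y * R y) - a * (Gπ 0 * R 0)) +
        (a - x) * (Gπ 0 * R 0) := by
    rw [hstep1, hξV, hWV, ← hR0]
    ring
  rw [htotal]
  calc |-(1 / (4 * π)) * (((∫ k in (-π)..(-Q), R (Real.sin k)) - x * R 0) + ((∫ k in Q..π, R (Real.sin k)) - x * R 0)) +
        (1 / 2 * (∫ y in Ioc (-a) a, liebWuG U Q univ y * R y) - a * (Gπ 0 * R 0)) +
        (a - x) * (Gπ 0 * R 0)|
      ≤ |-(1 / (4 * π)) * (((∫ k in (-π)..(-Q), R (Real.sin k)) - x * R 0) + ((∫ k in Q..π, R (Real.sin k)) - x * R 0))| +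
        |1 / 2 * (∫ y in Ioc (-a) a, liebWuG U Q univ y * R y) - a * (Gπ 0 * R 0)| +
        |(a - x) * (Gπ 0 * R 0)| := abs_add_three _ _ _
    _ ≤ 1 / (4 * π) * (4 / c ^ 2) * x ^ 2 + M * x ^ 2 + 1 / (π * c) * (1 / 2) * |I4| / 6 * x ^ 2 :=
        add_le_add (add_le_add hT1 hT2) hT3
    _ = (M + 1 / (4 * π) * 2 * (2 / c ^ 2) + 1 / (π * c) * (1 / 2) * |I4| / 6) * x ^ 2 := by ring
    _ = (M + 1 / (4 * π) * 2 * (2 / c ^ 2) + 1 / (π * c) * (1 / 2) * |I4| / 6) * (π - Q) ^ 2 := by rw [hx_def]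

end Literature.MathematicalPhysics.QuantumLattice
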